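import Literature.Topology.PlaneTopology.ArgumentIncrement
import Literature.Probability.LatticeModels.LatticeLoopEnclosure
import Literature.Probability.LatticeModels.DomainDiscretisation
import HarnessLib

/-!
# Negative knowledge on crux `LeftRightFKG`, part 1: unit lattice segments and the vertical probe

Points of a unit lattice segment have an integral coordinate; the crossing defect
(`Path.crossInc`) of one unit edge relative to the vertical probe `[ℓ, r]`,
`ℓ = (m+½) + (k+½)i` (a face centre), `r = (m+½) + (Y+¾)i`, is `-2πi · edgeCross` (`crossInc_edge`).
Used by parts 2–5 (`…/Negative/WithoutBoundaryAdjacency.lean`). [folklore]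
-/

noncomputable section

open Real Set Complex Literature.Probability.LatticeModels Literature.Topology.PlaneTopology

namespace Summit.CriticalPhenomena.SAWScalingLimit.Theorems.LeftRightFKG.Negative

/-! ## Lattice points and unit segments -/

/-- The complex point of a site (`= meshPoint 1`). [folklore] -/
abbrev pt (x : Site 2) : ℂ := Site.toComplex x

/-- `meshPoint_one` (auxiliary). [folklore] -/
@[simp] theorem meshPoint_one (x : Site 2) : meshPoint 1 x = pt x := by
  simp [meshPoint]

/-- `pt_re` (auxiliary). [folklore] -/
@[simp] theorem pt_re (x : Site 2) : (pt x).re = x 0 := rfl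
/-- `pt_im` (auxiliary). [folklore] -/
@[simp] theorem pt_im (x : Site 2) : (pt x).im = x 1 := rfl

/-- The four ways two sites can be lattice neighbours. [folklore] -/
theorem adj_cases {p q : Site 2} (h : (zdGraph 2).Adj p q) :
    (q 0 = p 0 + 1 ∧ q 1 = p 1) ∨ (p 0 = q 0 + 1 ∧ q 1 = p 1) ∨
      (q 1 = p 1 + 1 ∧ q 0 = p 0) ∨ (p 1 = q 1 + 1 ∧ q 0 = p 0) := by
  obtain ⟨i, hq | hp⟩ := (zdGraph_adj_iff p q).1 h
  · fin_cases i
    · left; constructor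
      · simp [hq]
      · simp [hq]
    · right; right; left; constructor
      · simp [hq]
      · simp [hq]
  · fin_cases i
    · right; left; constructor
      · simp [hp]
      · simp [hp]
    · right; right; right; constructor
      · simp [hp]
      · simp [hp]

/-- A point of a segment is a convex combination (real and imaginary parts). [folklore] -/
theorem exists_of_mem_segment {a b z : ℂ} (hz : z ∈ segment ℝ a b) :
    ∃ t : ℝ, 0 ≤ t ∧ t ≤ 1 ∧ z.re = (1 - t) * a.re + t * b.re ∧ z.im = (1 - t) * a.im + t * b.im := by
  rw [segment_eq_image_lineMap] at hz
  obtain ⟨t, ⟨ht0, ht1⟩, rfl⟩ := hz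
  refine ⟨t, ht0, ht1, ?_, ?_⟩
  · simp [AffineMap.lineMap_apply_module]
  · simp [AffineMap.lineMap_apply_module]

/-- On a unit lattice segment one coordinate is constant and integral: horizontal case. [folklore] -/
theorem im_eq_of_mem_segment {p q : Site 2} (h1 : q 1 = p 1) {z : ℂ} (hz : z ∈ segment ℝ (pt p) (pt q)) :
    z.im = p 1 := by
  obtain ⟨t, -, -, -, him⟩ := exists_of_mem_segment hz
  rw [him, pt_im, pt_im, h1]; ring

/-- Vertical case. [folklore] -/
theorem re_eq_of_mem_segment {p q : Site 2} (h0 : q 0 = p 0) {z : ℂ} (hz : z ∈ segment ℝ (pt p) (pt q)) :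
    z.re = p 0 := by
  obtain ⟨t, -, -, hre, -⟩ := exists_of_mem_segment hz
  rw [hre, pt_re, pt_re, h0]; ring

/-- Real parts along a segment stay between the endpoints' real parts. [folklore] -/
theorem re_mem_of_mem_segment {a b z : ℂ} (hz : z ∈ segment ℝ a b) :
    min a.re b.re ≤ z.re ∧ z.re ≤ max a.re b.re := by
  obtain ⟨t, ht0, ht1, hre, -⟩ := exists_of_mem_segment hz
  rw [hre]
  constructor
  · have h1 := min_le_left a.re b.re; have h2 := min_le_right a.re b.re; nlinarith
  · have h1 := le_max_left a.re b.re; have h2 := le_max_right a.re b.re; nlinarith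

/-- Imaginary parts along a segment stay between the endpoints' imaginary parts. [folklore] -/
theorem im_mem_of_mem_segment {a b z : ℂ} (hz : z ∈ segment ℝ a b) :
    min a.im b.im ≤ z.im ∧ z.im ≤ max a.im b.im := by
  obtain ⟨t, ht0, ht1, -, him⟩ := exists_of_mem_segment hz
  rw [him]
  constructor
  · have h1 := min_le_left a.im b.im; have h2 := min_le_right a.im b.im; nlinarith
  · have h1 := le_max_left a.im b.im; have h2 := le_max_right a.im b.im; nlinarith

/-- **A point of a unit lattice segment has an integral coordinate.** [folklore] -/
theorem exists_int_of_mem_segment {p q : Site 2} (h : (zdGraph 2).Adj p q) {z : ℂ}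
    (hz : z ∈ segment ℝ (pt p) (pt q)) : (∃ n : ℤ, z.re = n) ∨ (∃ n : ℤ, z.im = n) := by
  rcases adj_cases h with ⟨-, h1⟩ | ⟨-, h1⟩ | ⟨-, h0⟩ | ⟨-, h0⟩
  · exact Or.inr ⟨p 1, im_eq_of_mem_segment h1 hz⟩
  · exact Or.inr ⟨p 1, im_eq_of_mem_segment h1 hz⟩
  · exact Or.inl ⟨p 0, re_eq_of_mem_segment h0 hz⟩
  · exact Or.inl ⟨p 0, re_eq_of_mem_segment h0 hz⟩

/-- A point both of whose coordinates are non-integral lies on no unit lattice segment. [folklore] -/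
theorem not_mem_segment_of_nonint {p q : Site 2} (h : (zdGraph 2).Adj p q) {z : ℂ}
    (hre : ∀ n : ℤ, z.re ≠ n) (him : ∀ n : ℤ, z.im ≠ n) : z ∉ segment ℝ (pt p) (pt q) := by
  intro hz
  rcases exists_int_of_mem_segment h hz with ⟨n, hn⟩ | ⟨n, hn⟩
  exacts [hre n hn, him n hn]

/-- `Y + 3/4` is not an integer. [folklore] -/
theorem threeQuarter_ne_int (Y n : ℤ) : (Y : ℝ) + 3 / 4 ≠ n := by
  intro h
  have h2 : (4 * Y + 3 : ℝ) = 4 * n := by linarith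
  have h3 : (4 * Y + 3 : ℤ) = 4 * n := by exact_mod_cast h2
  omega

/-! ## The vertical probe segment and the crossing number of a unit edge -/

/-- Bottom of the probe: the centre of the face with lower-left corner `(m, k)`. [folklore] -/
def probeL (m k : ℤ) : ℂ := ⟨m + 1 / 2, k + 1 / 2⟩
/-- Top of the probe: above the row `Y`. [folklore] -/
def probeR (m Y : ℤ) : ℂ := ⟨m + 1 / 2, Y + 3 / 4⟩

/-- `probeL_re` (auxiliary). [folklore] -/
@[simp] theorem probeL_re (m k : ℤ) : (probeL m k).re = m + 1 / 2 := rfl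
/-- `probeL_im` (auxiliary). [folklore] -/
@[simp] theorem probeL_im (m k : ℤ) : (probeL m k).im = k + 1 / 2 := rfl
/-- `probeR_re` (auxiliary). [folklore] -/
@[simp] theorem probeR_re (m Y : ℤ) : (probeR m Y).re = m + 1 / 2 := rfl
/-- `probeR_im` (auxiliary). [folklore] -/
@[simp] theorem probeR_im (m Y : ℤ) : (probeR m Y).im = Y + 3 / 4 := rfl

/-- The signed crossing number of the dart `p → q` over the probe: `+1` for the eastward unit edge
`(m, y) → (m+1, y)` with `k + 1 ≤ y`, `-1` for the westward one, `0` otherwise. [folklore] -/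
def edgeCross (m k : ℤ) (p q : Site 2) : ℤ :=
  if p 0 = m ∧ q 0 = m + 1 ∧ q 1 = p 1 ∧ k + 1 ≤ p 1 then 1
  else if q 0 = m ∧ p 0 = m + 1 ∧ q 1 = p 1 ∧ k + 1 ≤ p 1 then -1 else 0

/-- `edgeCross_symm` (auxiliary). [folklore] -/
theorem edgeCross_symm (m k : ℤ) (p q : Site 2) : edgeCross m k q p = -edgeCross m k p q := by
  unfold edgeCross
  split_ifs <;> omega

/-- `segSide` of the probe at a point: proportional to the horizontal offset. [folklore] -/
theorem segSide_probe (m k Y : ℤ) (z : ℂ) :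
    segSide (probeL m k) (probeR m Y) z = (z.re - (m + 1 / 2)) * ((Y : ℝ) + 3 / 4 - (k + 1 / 2)) := by
  simp only [segSide, probeL, probeR, mul_im, sub_re, sub_im, conj_re, conj_im]
  ring


/-- Integers below a half-integer. [folklore] -/
theorem int_le_of_le_half {a m : ℤ} (h : (a : ℝ) ≤ m + 1 / 2) : a ≤ m := by
  by_contra h'
  have : (m : ℝ) + 1 ≤ a := by exact_mod_cast (show m + 1 ≤ a by omega)
  linarith

/-- Integers above a half-integer. [folklore] -/
theorem int_lt_of_half_le {a m : ℤ} (h : (m : ℝ) + 1 / 2 ≤ a) : m + 1 ≤ a := by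
  by_contra h'
  have : (a : ℝ) ≤ m := by exact_mod_cast (show a ≤ m by omega)
  linarith

/-- Points of the probe segment. [folklore] -/
theorem re_im_of_mem_probe {m k Y : ℤ} (hkY : k ≤ Y) {z : ℂ}
    (hz : z ∈ segment ℝ (probeL m k) (probeR m Y)) :
    z.re = m + 1 / 2 ∧ (k : ℝ) + 1 / 2 ≤ z.im ∧ z.im ≤ Y + 3 / 4 := by
  obtain ⟨t, ht0, ht1, hre, him⟩ := exists_of_mem_segment hz
  simp only [probeL_re, probeR_re, probeL_im, probeR_im] at hre him
  refine ⟨by rw [hre]; ring, ?_, ?_⟩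
  · rw [him]; have : (k : ℝ) ≤ Y := by exact_mod_cast hkY
    nlinarith
  · rw [him]; have : (k : ℝ) ≤ Y := by exact_mod_cast hkY
    nlinarith

/-- The probe endpoints lie on no unit lattice segment. [folklore] -/
theorem probeL_not_mem_segment (m k : ℤ) {p q : Site 2} (h : (zdGraph 2).Adj p q) :
    probeL m k ∉ segment ℝ (pt p) (pt q) :=
  not_mem_segment_of_nonint h (fun n => by rw [probeL_re]; exact int_add_half_ne_int m n)
    (fun n => by rw [probeL_im]; exact int_add_half_ne_int k n)

/-- `probeR_not_mem_segment` (auxiliary). [folklore] -/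
theorem probeR_not_mem_segment (m Y : ℤ) {p q : Site 2} (h : (zdGraph 2).Adj p q) :
    probeR m Y ∉ segment ℝ (pt p) (pt q) :=
  not_mem_segment_of_nonint h (fun n => by rw [probeR_re]; exact int_add_half_ne_int m n)
    (fun n => by rw [probeR_im]; exact threeQuarter_ne_int Y n)

/-- The crossing point `(m+½, y)` lies in the open probe segment when `k+1 ≤ y ≤ Y`. [folklore] -/
theorem mem_openSegment_probe {m k Y y : ℤ} (hkY : k ≤ Y) (hk : k + 1 ≤ y) (hy : y ≤ Y) :
    (⟨m + 1 / 2, y⟩ : ℂ) ∈ openSegment ℝ (probeL m k) (probeR m Y) := by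
  have hD : (0 : ℝ) < (Y : ℝ) + 3 / 4 - (k + 1 / 2) := by
    have : (k : ℝ) ≤ Y := by exact_mod_cast hkY
    linarith
  have hk' : (k : ℝ) + 1 ≤ y := by exact_mod_cast hk
  have hy' : (y : ℝ) ≤ Y := by exact_mod_cast hy
  rw [openSegment_eq_image_lineMap]
  set t : ℝ := ((y : ℝ) - (k + 1 / 2)) / ((Y : ℝ) + 3 / 4 - (k + 1 / 2)) with ht
  refine ⟨t, ⟨?_, ?_⟩, ?_⟩
  · apply div_pos <;> linarith
  · rw [ht, div_lt_one hD]; linarith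
  · rw [AffineMap.lineMap_apply_module]
    have htD : t * ((Y : ℝ) + 3 / 4 - (k + 1 / 2)) = (y : ℝ) - (k + 1 / 2) := by
      rw [ht, div_mul_cancel₀ _ hD.ne']
    apply Complex.ext
    · simp only [Complex.add_re, Complex.smul_re, smul_eq_mul, probeL_re, probeR_re]; ring
    · simp only [Complex.add_im, Complex.smul_im, smul_eq_mul, probeL_im, probeR_im]; nlinarith

/-- **Crossing defect of one unit edge** (all heights `≤ Y`): `-2πi · edgeCross`. [folklore] -/
theorem crossInc_edge {m k Y : ℤ} (hkY : k ≤ Y) {p q : Site 2} (h : (zdGraph 2).Adj p q)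
    (hp : p 1 ≤ Y) :
    (Path.segment (pt p) (pt q)).crossInc (probeL m k) (probeR m Y) =
      -(2 * π * I) * edgeCross m k p q := by
  have hD : (0 : ℝ) < (Y : ℝ) + 3 / 4 - (k + 1 / 2) := by
    have : (k : ℝ) ≤ Y := by exact_mod_cast hkY
    linarith
  unfold edgeCross
  split_ifs with hE hW
  · -- eastward crossing edge
    obtain ⟨hp0, hq0, hq1, hk⟩ := hE
    have hA : segSide (probeL m k) (probeR m Y) (pt p) < 0 := by
      rw [segSide_probe, pt_re, hp0]; nlinarith
    have hB : 0 < segSide (probeL m k) (probeR m Y) (pt q) := by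
      rw [segSide_probe, pt_re, hq0]; push_cast; nlinarith
    have hx : ∃ x ∈ segment ℝ (pt p) (pt q), x ∈ openSegment ℝ (probeL m k) (probeR m Y) := by
      refine ⟨⟨m + 1 / 2, p 1⟩, ?_, ?_⟩
      · rw [segment_eq_image_lineMap]
        refine ⟨1 / 2, ⟨by norm_num, by norm_num⟩, ?_⟩
        apply Complex.ext
        · simp [AffineMap.lineMap_apply_module, hp0, hq0]; ring
        · simp [AffineMap.lineMap_apply_module, hq1]; ring
      · exact mem_openSegment_probe hkY hk hp
    rw [Path.crossInc_segment_of_cross' hA hB hx]; simp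
  · -- westward crossing edge
    obtain ⟨hq0, hp0, hq1, hk⟩ := hW
    have hA : 0 < segSide (probeL m k) (probeR m Y) (pt p) := by
      rw [segSide_probe, pt_re, hp0]; push_cast; nlinarith
    have hB : segSide (probeL m k) (probeR m Y) (pt q) < 0 := by
      rw [segSide_probe, pt_re, hq0]; nlinarith
    have hx : ∃ x ∈ segment ℝ (pt p) (pt q), x ∈ openSegment ℝ (probeL m k) (probeR m Y) := by
      refine ⟨⟨m + 1 / 2, p 1⟩, ?_, ?_⟩
      · rw [segment_eq_image_lineMap]
        refine ⟨1 / 2, ⟨by norm_num, by norm_num⟩, ?_⟩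
        apply Complex.ext
        · simp [AffineMap.lineMap_apply_module, hp0, hq0]; ring
        · simp [AffineMap.lineMap_apply_module, hq1]; ring
      · exact mem_openSegment_probe hkY hk hp
    rw [Path.crossInc_segment_of_cross hA hB hx]; simp
  · -- no crossing
    rw [Path.crossInc_eq_zero]
    · simp
    intro t ht
    have hz : (Path.segment (pt p) (pt q)) t ∈ segment ℝ (pt p) (pt q) := by
      rw [← Path.range_segment]; exact ⟨t, rfl⟩
    obtain ⟨hre, him, -⟩ := re_im_of_mem_probe hkY ht
    obtain ⟨hlo, hhi⟩ := re_mem_of_mem_segment hz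
    rw [hre, pt_re, pt_re] at hlo hhi
    rcases adj_cases h with ⟨h0, h1⟩ | ⟨h0, h1⟩ | ⟨h1, h0⟩ | ⟨h1, h0⟩
    · rw [h0] at hlo hhi
      push_cast at hlo hhi
      rw [min_eq_left (by linarith)] at hlo
      rw [max_eq_right (by linarith)] at hhi
      have e1 : p 0 ≤ m := int_le_of_le_half hlo
      have e2 : m + 1 ≤ p 0 + 1 := int_lt_of_half_le (by push_cast; linarith)
      have hzim : ((Path.segment (pt p) (pt q)) t).im = p 1 := im_eq_of_mem_segment h1 hz
      rw [hzim] at him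
      have e4 : k + 1 ≤ p 1 := int_lt_of_half_le him
      exact hE ⟨by omega, by omega, h1, e4⟩
    · rw [h0] at hlo hhi
      push_cast at hlo hhi
      rw [min_eq_right (by linarith)] at hlo
      rw [max_eq_left (by linarith)] at hhi
      have e1 : q 0 ≤ m := int_le_of_le_half hlo
      have e2 : m + 1 ≤ q 0 + 1 := int_lt_of_half_le (by push_cast; linarith)
      have hzim : ((Path.segment (pt p) (pt q)) t).im = p 1 := im_eq_of_mem_segment h1 hz
      rw [hzim] at him
      have e4 : k + 1 ≤ p 1 := int_lt_of_half_le him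
      exact hW ⟨by omega, by omega, h1, e4⟩
    · have hzre : ((Path.segment (pt p) (pt q)) t).re = p 0 := re_eq_of_mem_segment h0 hz
      rw [hzre] at hre
      exact int_add_half_ne_int m (p 0) hre.symm
    · have hzre : ((Path.segment (pt p) (pt q)) t).re = p 0 := re_eq_of_mem_segment h0 hz
      rw [hzre] at hre
      exact int_add_half_ne_int m (p 0) hre.symm

end Summit.CriticalPhenomena.SAWScalingLimit.Theorems.LeftRightFKG.Negative
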